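import Summits.Ventures.ResidMod.Mod2A5bVerdict
import Summits.Ventures.ResidMod.Mod3SurjectiveSlots
import Summits.Ventures.ResidMod.EulerFactorDualFrame
import Summits.Ventures.ResidMod.TorsionUnramified
import Literature.NumberTheory.DiophantineGeometry.Bcgp2025GoodOrdinaryPDistinguished
import Literature.NumberTheory.DiophantineGeometry.OrdinaryReductionMiddleCoefficient
import HarnessLib

/-!
# Venture ResidMod — FULL-CHAIN verdicts: the local slots at `2` (T-2) and at `3` (T-L) from Euler
# factors and a good-reduction binder, via the two published criteria typed by the LIT seats

HONEST FRAMING. Interface file of a COMPUTATION cell (`pub-residmod`). NO surface is claimed modular;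
every datum is a binder; ALL cited theorems enter as hypotheses (named facts of the tree, typed as
printed by the cell's LIT seats, NOT proved in the tree):
* `h832` = `bcgp_residuallyA5b_modular_abelianSurface` (BCGP 2025 Thm. 8.3.2) — T-2;
* `h111` = `bcgp2025_modThreeSurjective_modular_abelianSurface` (BCGP 2025 Thm. 1.1.1) — T-L;
* `hB2` = `bcgp2025_goodOrdinary_pDistinguished_abelianSurface` (BCGP 2025 Def. 9.1.2 / §1.8: good
  ordinary at `p` ∧ Frobenius polynomial at `p` without repeated roots ⟹ `ρ_{A,p}|_{G_{ℚ_p}}` ordinary and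
  `p`-distinguished) — bridge B2;
* `hDel` = `deligne_hasGoodOrdinaryReductionAt_iff_not_dvd_middleCoeff` (Deligne 1969 / Howe 1995:
  under good reduction at `p`, ordinary ⟺ `p ∤ b_p`, the middle coefficient of `L_p`) — bridge B5.
With these, the LOCAL slots of a census row reduce to: Euler factors (`HasGoodEulerFactorAt`, the
engines' exact point counts) with numeric side conditions decided in the kernel (parities, `p ∤ b_p`,
a Bézout identity for separability), and ONE modelling binder per prime, `HasGoodReductionAt A.X A.dim v`
("the curve's Jacobian has good reduction at `p`": `p ∤` conductor; the tree's scheme-theoretic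
predicate, not derivable from point counts). The residual-image slots are unchanged (T-2: Weierstrass
frame, one real Weierstrass point; T-L: torsion frame, SURJECTIVE verdict of the offline checker,
unramified at `2`).

* `modular_of_mod2Row` — T-2: `F`, `L_{q₅}` (odd/odd), `L_{q₃}` (odd/even), `hcc`, `L₂ = (a₂,b₂)` with
  `b₂` odd (ORD(2) via `hDel`) and `L₂(T)` separable (DIST0(2); with ORD(2) this is "Q₂ not a square"),
  `GOOD(2)` ⟹ every framed dual of every `V_p(A)` is `IsAutomorphicAE`.
* `modular_of_mod3Row` — T-L: `ρb` + torsion frame, `hsurj`, `hunr`, `L₂ = (a₂,b₂)` with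
  `¬(b₂ ≡ 2 ∧ a₂ ≢ 0 mod 3)` (F2OK), `L₃ = (a₃,b₃)` with `3 ∤ b₃` (ORD(3) via `hDel`) and `L₃(T)`
  separable (DIST0(3)), `GOOD(3)` ⟹ the same conclusion.

References: [BoxerCalegariGeePilloni2025] arXiv:2502.20645 Thm. 1.1.1, Thm. 8.3.2, Def. 9.1.2, §1.8,
§9.2; [Deligne1969OrdinaryAV] §2; [Howe1995OrdinaryAV] Def. 3.1; [BrumerEtAl2019] (4.1.5).
-/

noncomputable section

namespace Summit.Ventures.ResidMod

open Equiv CategoryTheory IsDedekindDomain Field Polynomial Matrix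
open scoped NumberField
open Literature.NumberTheory.GaloisRepresentations Literature.NumberTheory.Automorphic
open Literature.NumberTheory.Automorphic.Paramodular
open Literature.NumberTheory.DiophantineGeometry Literature.NumberTheory.FaltingsSerre
open Literature.AlgebraicGeometry.Motives (AbelianVariety HasGoodReductionAt)

variable {A : AbelianVariety ℚ}

/-- **The ordinary-and-`p`-distinguished slot from `L_p`** (bridges B5 + B3 + B2): for an abelian
surface with good reduction at `v ∣ p` (`hgood`, binder), Euler factor `L_p = 1 − aT + bT² − paT³ + p²T⁴`
with `p ∤ b` (ordinary, Deligne's criterion `hDel`) and `L_p(T)` separable over `ℚ` (no repeated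
Frobenius roots, bridge B3), every framed dual of `V_p(A)` is ordinary and `p`-distinguished at `v`
(`hB2`, BCGP 2025 Def. 9.1.2). [cite: BoxerCalegariGeePilloni2025, Def. 9.1.2] [cite: Deligne1969OrdinaryAV, §2] [cite: Howe1995OrdinaryAV, Def. (3.1)] -/
theorem isOrdinaryPDistinguishedAt_of_eulerData
    (hB2 : bcgp2025_goodOrdinary_pDistinguished_abelianSurface)
    (hDel : deligne_hasGoodOrdinaryReductionAt_iff_not_dvd_middleCoeff)
    (hA : A.dim = 2) {p : ℕ} [Fact p.Prime] {a b : ℤ}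
    (hL : A.HasGoodEulerFactorAt p ((lPolynomialOfSurface p a b).map (Int.castRingHom ℚ)))
    (hb : ¬ (p : ℤ) ∣ b) (hsep : ((lPolynomialOfSurface p a b).map (Int.castRingHom ℚ)).Separable)
    (hgood : ∀ v : HeightOneSpectrum (𝓞 ℚ), ((p : ℕ) : 𝓞 ℚ) ∈ v.asIdeal → HasGoodReductionAt A.X A.dim v) :
    ∀ (b' : Module.Basis (Fin 4) ℚ_[p] (A.rationalTateModule p)) (r : FramedGaloisRep ℚ (PadicAlgCl p) 4),
      (∀ g : absoluteGaloisGroup ℚ,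
        (r g).val =
          ((LinearMap.toMatrix b' b' (A.rationalTateRep p g⁻¹)).map
            (algebraMap ℚ_[p] (PadicAlgCl p))).transpose) →
      ∀ v : HeightOneSpectrum (𝓞 ℚ), ((p : ℕ) : 𝓞 ℚ) ∈ v.asIdeal → r.IsOrdinaryPDistinguishedAt v := by
  intro b' r hr v hv
  exact hB2 A hA p v hv (hasGoodOrdinaryReductionAt_of_not_dvd_middleCoeff hDel hA hL hb hv (hgood v hv))
    (fun ℓ _ hℓ b'' r' hr' =>
      separable_dualFrame_of_hasGoodEulerFactorAt hL (coeff_zero_lPolynomialOfSurface_map_ne_zero p a b) hsep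
        ℓ hℓ b'' r' hr' v hv)
    b' r hr

/-- **T-2 census row, full chain.**  GIVEN the three named facts (`h832` Thm. 8.3.2, `hB2` Def. 9.1.2,
`hDel` Deligne's criterion): a Weierstrass `2`-torsion frame `F`, good Euler factors at odd `q₅`
(`a, b` odd) and `q₃` (`a` odd, `b` even), complex conjugations moving four Weierstrass points, the Euler
factor at `2` with `b₂` odd and `L₂(T)` separable, and good reduction at `2` (`hgood₂`, binder) ⟹
every framed dual of every `V_p(A)` is `IsAutomorphicAE`. Kernel-derived: GAL5, the semistable clause,
ORD(2), DIST0(2) ⟹ `2`-distinguished. CONDITIONAL on the three facts; every datum a binder.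
[cite: BoxerCalegariGeePilloni2025, Thm. 8.3.2, Def. 9.1.2, §8.1] [cite: Deligne1969OrdinaryAV, §2] [cite: Howe1995OrdinaryAV, Def. (3.1)] -/
theorem modular_of_mod2Row (h832 : bcgp_residuallyA5b_modular_abelianSurface)
    (hB2 : bcgp2025_goodOrdinary_pDistinguished_abelianSurface)
    (hDel : deligne_hasGoodOrdinaryReductionAt_iff_not_dvd_middleCoeff)
    (A : AbelianVariety ℚ) (hA : A.dim = 2) (F : WeierstrassTwoTorsionFrame A)
    {q₅ : ℕ} (hq₅ : q₅.Prime) (hq₅2 : q₅ ≠ 2) {a₅ b₅ : ℤ}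
    (hL₅ : A.HasGoodEulerFactorAt q₅ ((lPolynomialOfSurface q₅ a₅ b₅).map (Int.castRingHom ℚ)))
    (ha₅ : Odd a₅) (hb₅ : Odd b₅)
    {q₃ : ℕ} (hq₃ : q₃.Prime) (hq₃2 : q₃ ≠ 2) {a₃ b₃ : ℤ}
    (hL₃ : A.HasGoodEulerFactorAt q₃ ((lPolynomialOfSurface q₃ a₃ b₃).map (Int.castRingHom ℚ)))
    (ha₃ : Odd a₃) (hb₃ : Even b₃)
    (hcc : ∀ c : absoluteGaloisGroup ℚ, IsComplexConjugation (algebraMap ℚ ℝ) c →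
      (F.perm c).support.card = 4)
    {a₂ b₂ : ℤ} (hL₂ : A.HasGoodEulerFactorAt 2 ((lPolynomialOfSurface 2 a₂ b₂).map (Int.castRingHom ℚ)))
    (hb₂ : ¬ (2 : ℤ) ∣ b₂) (hsep₂ : ((lPolynomialOfSurface 2 a₂ b₂).map (Int.castRingHom ℚ)).Separable)
    (hgood₂ : ∀ v : HeightOneSpectrum (𝓞 ℚ), ((2 : ℕ) : 𝓞 ℚ) ∈ v.asIdeal → HasGoodReductionAt A.X A.dim v) :
    ∀ (p : ℕ) [Fact p.Prime] (b : Module.Basis (Fin 4) ℚ_[p] (A.rationalTateModule p))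
      (r : FramedGaloisRep ℚ (PadicAlgCl p) 4),
      (∀ g : absoluteGaloisGroup ℚ,
        (r g).val =
          ((LinearMap.toMatrix b b (A.rationalTateRep p g⁻¹)).map
            (algebraMap ℚ_[p] (PadicAlgCl p))).transpose) →
      ∀ (hcpt : isCompact_glFiniteIntegralLevel 4 ℚ) (ι : PadicAlgCl p ≃+* ℂ),
        IsAutomorphicAE ι hcpt r :=
  haveI : Fact (Nat.Prime 2) := ⟨Nat.prime_two⟩
  modular_of_mod2EulerCertificate h832 A hA F hq₅ hq₅2 hL₅ ha₅ hb₅ hq₃ hq₃2 hL₃ ha₃ hb₃ hcc hL₂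
    (isOrdinaryPDistinguishedAt_of_eulerData hB2 hDel hA hL₂ hb₂ hsep₂ hgood₂)

/-- **T-L census row, full chain.**  GIVEN `h111` (Thm. 1.1.1) and `hDel` (Deligne's criterion): a
torsion frame for `ρb` (TORS3), the surjectivity slot `hsurj` (offline checker), `ρb` unramified at `2`
(`hunr`), `L₂ = (a₂,b₂)` with `¬(b₂ ≡ 2 ∧ a₂ ≢ 0 mod 3)` (F2OK, kernel), `L₃ = (a₃,b₃)` with `3 ∤ b₃`
(ORD(3) via `hDel`) and `L₃(T)` separable (DIST0(3), kernel), and good reduction at `3` (`hgood₃`,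
binder) ⟹ every framed dual of every `V_p(A)` is `IsAutomorphicAE`. CONDITIONAL on the two facts;
every datum a binder. [cite: BoxerCalegariGeePilloni2025, Thm. 1.1.1, Lemma 9.1.3, Def. 9.1.2] [cite: Deligne1969OrdinaryAV, §2] [cite: Howe1995OrdinaryAV, Def. (3.1)] -/
theorem modular_of_mod3Row (h111 : bcgp2025_modThreeSurjective_modular_abelianSurface)
    (hDel : deligne_hasGoodOrdinaryReductionAt_iff_not_dvd_middleCoeff)
    (A : AbelianVariety ℚ) (hA : A.dim = 2) (ρb : FramedGaloisRep ℚ (ZMod 3) 4)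
    (hframe : ∃ e₃ : A.geomTorsion (3 : ℕ) ≃+ (Fin 4 → ZMod 3),
      ∀ (g : absoluteGaloisGroup ℚ) (P : A.geomTorsion (3 : ℕ)),
        e₃ (g • P) = ((ρb g⁻¹ : GL (Fin 4) (ZMod 3)) : Matrix (Fin 4) (Fin 4) (ZMod 3))ᵀ *ᵥ e₃ P)
    (hsurj : ∃ J : Matrix (Fin 4) (Fin 4) (ZMod 3), Jᵀ = -J ∧ IsUnit J.det ∧
      (∀ σ : absoluteGaloisGroup ℚ,
        (ρb σ).valᵀ * J * (ρb σ).val =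
          (((modPCyclotomicCharacterZMod ℚ 3 σ)⁻¹ : (ZMod 3)ˣ) : ZMod 3) • J) ∧
      ∀ M : Matrix (Fin 4) (Fin 4) (ZMod 3),
        (∃ c : (ZMod 3)ˣ, Mᵀ * J * M = (c : ZMod 3) • J) →
          ∃ σ : absoluteGaloisGroup ℚ, (ρb σ).val = M)
    (hunr : ∀ v : HeightOneSpectrum (𝓞 ℚ), ((2 : ℕ) : 𝓞 ℚ) ∈ v.asIdeal → ρb.IsUnramifiedAt v)
    {a₂ b₂ : ℤ} (hL2 : A.HasGoodEulerFactorAt 2 ((lPolynomialOfSurface 2 a₂ b₂).map (Int.castRingHom ℚ)))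
    (hab : ¬ (((b₂ : ℤ) : ZMod 3) = 2 ∧ ((a₂ : ℤ) : ZMod 3) ≠ 0))
    {a₃ b₃ : ℤ} (hL3 : A.HasGoodEulerFactorAt 3 ((lPolynomialOfSurface 3 a₃ b₃).map (Int.castRingHom ℚ)))
    (hb₃ : ¬ (3 : ℤ) ∣ b₃) (hsepL : ((lPolynomialOfSurface 3 a₃ b₃).map (Int.castRingHom ℚ)).Separable)
    (hgood₃ : ∀ v : HeightOneSpectrum (𝓞 ℚ), ((3 : ℕ) : 𝓞 ℚ) ∈ v.asIdeal → HasGoodReductionAt A.X A.dim v) :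
    ∀ (p : ℕ) [Fact p.Prime] (b : Module.Basis (Fin 4) ℚ_[p] (A.rationalTateModule p))
      (r : FramedGaloisRep ℚ (PadicAlgCl p) 4),
      (∀ g : absoluteGaloisGroup ℚ,
        (r g).val =
          ((LinearMap.toMatrix b b (A.rationalTateRep p g⁻¹)).map
            (algebraMap ℚ_[p] (PadicAlgCl p))).transpose) →
      ∀ (hcpt : isCompact_glFiniteIntegralLevel 4 ℚ) (ι : PadicAlgCl p ≃+* ℂ),
        IsAutomorphicAE ι hcpt r :=
  haveI : Fact (Nat.Prime 3) := ⟨Nat.prime_three⟩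
  modular_of_mod3Slots_of_bcgp2025 h111 A hA ρb hframe hsurj hunr hL2 hab
    (fun v hv => hasGoodOrdinaryReductionAt_of_not_dvd_middleCoeff hDel hA hL3 hb₃ hv (hgood₃ v hv))
    hL3 hsepL

/-- **T-L census row, full chain with UNRAM2 derived.**  As `modular_of_mod3Row`, but the slot
"`ρ̄_{A,3}` unramified at `2`" is DERIVED from the Euler factor at `2`
(`torsionRep_isUnramifiedAt_of_hasGoodEulerFactorAt`: good Euler factor ⟹ `V₃(A)` unramified at `2` ⟹
`A[3]` unramified at `2`). Remaining binders: the torsion frame (`ρb`, `hframe`), the surjectivity slot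
`hsurj` (offline checker), good reduction at `3` (`hgood₃`); Euler factors `L₂ = (a₂,b₂)` (F2OK and
UNRAM2, kernel) and `L₃ = (a₃,b₃)` (ORD(3) via `hDel`, DIST0(3) by a Bézout identity); the named facts
`h111`, `hDel`. [cite: BoxerCalegariGeePilloni2025, Thm. 1.1.1, Lemma 9.1.3, Def. 9.1.2] [cite: SerreTate1968, §1 Thm. 1] -/
theorem modular_of_mod3Row' (h111 : bcgp2025_modThreeSurjective_modular_abelianSurface)
    (hDel : deligne_hasGoodOrdinaryReductionAt_iff_not_dvd_middleCoeff)
    (A : AbelianVariety ℚ) (hA : A.dim = 2) (ρb : FramedGaloisRep ℚ (ZMod 3) 4)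
    (hframe : ∃ e₃ : A.geomTorsion (3 : ℕ) ≃+ (Fin 4 → ZMod 3),
      ∀ (g : absoluteGaloisGroup ℚ) (P : A.geomTorsion (3 : ℕ)),
        e₃ (g • P) = ((ρb g⁻¹ : GL (Fin 4) (ZMod 3)) : Matrix (Fin 4) (Fin 4) (ZMod 3))ᵀ *ᵥ e₃ P)
    (hsurj : ∃ J : Matrix (Fin 4) (Fin 4) (ZMod 3), Jᵀ = -J ∧ IsUnit J.det ∧
      (∀ σ : absoluteGaloisGroup ℚ,
        (ρb σ).valᵀ * J * (ρb σ).val =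
          (((modPCyclotomicCharacterZMod ℚ 3 σ)⁻¹ : (ZMod 3)ˣ) : ZMod 3) • J) ∧
      ∀ M : Matrix (Fin 4) (Fin 4) (ZMod 3),
        (∃ c : (ZMod 3)ˣ, Mᵀ * J * M = (c : ZMod 3) • J) →
          ∃ σ : absoluteGaloisGroup ℚ, (ρb σ).val = M)
    {a₂ b₂ : ℤ} (hL2 : A.HasGoodEulerFactorAt 2 ((lPolynomialOfSurface 2 a₂ b₂).map (Int.castRingHom ℚ)))
    (hab : ¬ (((b₂ : ℤ) : ZMod 3) = 2 ∧ ((a₂ : ℤ) : ZMod 3) ≠ 0))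
    {a₃ b₃ : ℤ} (hL3 : A.HasGoodEulerFactorAt 3 ((lPolynomialOfSurface 3 a₃ b₃).map (Int.castRingHom ℚ)))
    (hb₃ : ¬ (3 : ℤ) ∣ b₃) (hsepL : ((lPolynomialOfSurface 3 a₃ b₃).map (Int.castRingHom ℚ)).Separable)
    (hgood₃ : ∀ v : HeightOneSpectrum (𝓞 ℚ), ((3 : ℕ) : 𝓞 ℚ) ∈ v.asIdeal → HasGoodReductionAt A.X A.dim v) :
    ∀ (p : ℕ) [Fact p.Prime] (b : Module.Basis (Fin 4) ℚ_[p] (A.rationalTateModule p))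
      (r : FramedGaloisRep ℚ (PadicAlgCl p) 4),
      (∀ g : absoluteGaloisGroup ℚ,
        (r g).val =
          ((LinearMap.toMatrix b b (A.rationalTateRep p g⁻¹)).map
            (algebraMap ℚ_[p] (PadicAlgCl p))).transpose) →
      ∀ (hcpt : isCompact_glFiniteIntegralLevel 4 ℚ) (ι : PadicAlgCl p ≃+* ℂ),
        IsAutomorphicAE ι hcpt r :=
  haveI : Fact (Nat.Prime 3) := ⟨Nat.prime_three⟩
  modular_of_mod3Row h111 hDel A hA ρb hframe hsurj
    (torsionRep_isUnramifiedAt_of_hasGoodEulerFactorAt hA hL2 (ℓ := 3) (by decide) ρb hframe)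
    hL2 hab hL3 hb₃ hsepL hgood₃

end Summit.Ventures.ResidMod

end
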